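import Mathlib.Combinatorics.SimpleGraph.Paths
import Mathlib.Combinatorics.SimpleGraph.Prod
import Mathlib.Combinatorics.SimpleGraph.Hasse
import HarnessLib

/-!
# Grids, walls and topological minors

Support notions for the treewidth lower bound for bounded-depth Frege proofs of
Tseitin formulas (Galesi–Itsykson–Riazanov–Sofronova, `Literature/Computability/MetaComplexity/
TseitinDepthFrege.lean`), whose proof starts from: *a graph of treewidth `t` contains the wall
`W_r`, `r = Ω(t^λ)`, as a topological minor* (GIRS Cor. 9, deduced there from the polynomial
Excluded Grid Theorem of Chekuri–Chuzhoy in the form of Chuzhoy–Tan, Thm. 1.1: "there exist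
constants `c₁, c₂ > 0` such that for every integer `g ≥ 2`, every graph of treewidth at least
`k = c₁ g⁹ log^{c₂} g` contains the `(g × g)`-grid as a minor", whence `λ ≥ 1/10`).

* `grid a b` — the grid `𝓗_{a,b}` ("the graph of the cellular rectangle `a × b`; it has
  `(a+1)(b+1)` vertices", GIRS §2): the box product of two paths, on `Fin (a+1) × Fin (b+1)`.
* `wall r` — the wall `W_r` (GIRS §2, Fig. 3): the subgraph of `𝓗_{r,r}` keeping all horizontal
  edges and, of the vertical edges `(i, j) — (i+1, j)`, exactly those with `i + j` even ("in the
  odd rows we remove all vertical edges with even numbers and in even rows we remove all vertical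
  edges with odd numbers", rows and numbers counted from `1`); `wall_le_grid`.
* `IsTopologicalMinor H G` (`H ≼ₜ G`) — `G` contains a subdivision of `H`: an injection `f` of the
  vertices of `H` (branch vertices) and, for every edge `uv` of `H`, a path of `G` from `f u` to
  `f v` whose only branch vertices are its ends, paths of distinct edges meeting only in branch
  vertices (Diestel, *Graph Theory*, §1.7: "`G` is a subdivision of `H` … `H` is a topological
  minor of `G`"; GIRS §2: "`H` can be obtained from `G` by a sequence of edge removals, vertex
  removals and vertex suppressions"). The path family is indexed by ORDERED adjacent pairs; the
  two orientations of one edge are not related to each other (a user picks one orientation per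
  edge), which keeps the definition free of choice and is equivalent to the usual notion.
  API: `IsTopologicalMinor.refl`, `IsTopologicalMinor.mono_right`, `IsTopologicalMinor.of_hom`.
* The polynomial Excluded Grid Theorem in wall form (GIRS Cor. 9 with Chuzhoy–Tan Thm. 1.1:
  there are `c > 0` and `t₁` such that every finite graph `G` with `tw(G) ≥ t₁` contains `W_r` as a
  topological minor for some `r ≥ c · tw(G)^{1/10}`) is NOT vendored here as a named fact; it is
  the explicit hypothesis `∃ c > 0, ∃ t₁, ∀ V [Fintype V] (G : SimpleGraph V), t₁ ≤ treewidth G →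
  ∃ r, c · (treewidth G)^{1/10} ≤ r ∧ wall r ≼ₜ G` of the conditional form of the GIRS bound in
  `Literature/Computability/MetaComplexity/TseitinDepthFregeProofs.lean`, stated with these
  definitions.

Mathlib has `SimpleGraph.Walk.IsPath`, box products and `pathGraph`, but no graph minors,
topological minors, subdivisions, grids-with-names or walls (searched `Minor`, `Subdivision`,
`wall`, `gridGraph`: only `Literature.Computability.QuantumComplexity.gridGraph N = pathGraph N □
pathGraph N`, the square case, which `grid` generalises without importing that file).

## References

* [GalesiEtAl2023] N. Galesi, D. Itsykson, A. Riazanov, A. Sofronova, *Bounded-depth Frege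
  complexity of Tseitin formulas for all graphs*, Ann. Pure Appl. Logic 174 (2023) 103166, §2
  (grids, walls, topological minors), Thm. 8, Cor. 9. Read: APAL text pp. 9–10.
* [ChuzhoyTan2021] J. Chuzhoy, Z. Tan, *Towards tight(er) bounds for the Excluded Grid Theorem*,
  J. Combin. Theory Ser. B 146 (2021) 219–265 (SODA 2019; arXiv:1901.07944), Thm. 1.1. Read:
  arXiv text p. 3.
* R. Diestel, *Graph Theory*, 5th ed., §1.7 (subdivisions and topological minors), §12.6
  (excluded grid theorem) — terminology only.
-/

namespace Literature.Combinatorics.SimpleGraph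

open _root_.SimpleGraph

/-! ### Grids and walls -/

/-- The **grid** `𝓗_{a,b}`: vertices `(i, j)`, `0 ≤ i ≤ a`, `0 ≤ j ≤ b`, two vertices adjacent iff
they differ by `1` in exactly one coordinate ("the graph of the cellular rectangle `a × b`; it has
`(a+1)(b+1)` vertices and `b(a+1) + a(b+1)` edges"). Realised as the box product of two paths.
[cite: GalesiEtAl2023, §2 (grids)] -/
abbrev grid (a b : ℕ) : SimpleGraph (Fin (a + 1) × Fin (b + 1)) :=
  pathGraph (a + 1) □ pathGraph (b + 1)

/-- The **wall** `W_r`: the subgraph of the grid `𝓗_{r,r}` with all horizontal edges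
`(i, j) — (i, j+1)` and the vertical edges `(i, j) — (i+1, j)` with `i + j` even (GIRS, Fig. 3:
numbering the rows of vertical edges and the edges within a row from `1`, the vertical edges with
even numbers are removed from odd rows and those with odd numbers from even rows; in `0`-based
coordinates the surviving vertical edge below `(i, j)` is the one with `i ≡ j (mod 2)`). Every
vertex has degree at most `3`. [cite: GalesiEtAl2023, §2 (walls, Fig. 3)] -/
def wall (r : ℕ) : SimpleGraph (Fin (r + 1) × Fin (r + 1)) where
  Adj p q :=
    (p.1 = q.1 ∧ ((p.2 : ℕ) + 1 = q.2 ∨ (q.2 : ℕ) + 1 = p.2)) ∨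
    (p.2 = q.2 ∧ (((p.1 : ℕ) + 1 = q.1 ∧ ((p.1 : ℕ) + p.2) % 2 = 0) ∨
      ((q.1 : ℕ) + 1 = p.1 ∧ ((q.1 : ℕ) + q.2) % 2 = 0)))
  symm := ⟨fun p q h => by
    rcases h with ⟨h1, h2⟩ | ⟨h1, h2⟩
    · exact Or.inl ⟨h1.symm, h2.symm⟩
    · exact Or.inr ⟨h1.symm, h2.symm⟩⟩
  loopless := ⟨fun p h => by
    rcases h with ⟨-, h2 | h2⟩ | ⟨-, ⟨h2, -⟩ | ⟨h2, -⟩⟩ <;> omega⟩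

/-- Adjacency in the wall, unfolded. [cite: GalesiEtAl2023, §2 (walls)] -/
theorem wall_adj {r : ℕ} {p q : Fin (r + 1) × Fin (r + 1)} :
    (wall r).Adj p q ↔
      (p.1 = q.1 ∧ ((p.2 : ℕ) + 1 = q.2 ∨ (q.2 : ℕ) + 1 = p.2)) ∨
      (p.2 = q.2 ∧ (((p.1 : ℕ) + 1 = q.1 ∧ ((p.1 : ℕ) + p.2) % 2 = 0) ∨
        ((q.1 : ℕ) + 1 = p.1 ∧ ((q.1 : ℕ) + q.2) % 2 = 0))) :=
  Iff.rfl

/-- Adjacency in the grid: equal first coordinates and consecutive second coordinates, or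
conversely. [cite: GalesiEtAl2023, §2 (grids)] -/
theorem grid_adj {a b : ℕ} {p q : Fin (a + 1) × Fin (b + 1)} :
    (grid a b).Adj p q ↔
      (p.1 = q.1 ∧ ((p.2 : ℕ) + 1 = q.2 ∨ (q.2 : ℕ) + 1 = p.2)) ∨
      (p.2 = q.2 ∧ ((p.1 : ℕ) + 1 = q.1 ∨ (q.1 : ℕ) + 1 = p.1)) := by
  rw [boxProd_adj, pathGraph_adj, pathGraph_adj]
  tauto

/-- **The wall is a subgraph of the grid** `𝓗_{r,r}` (it is obtained by removing vertical edges).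
[cite: GalesiEtAl2023, §2 (walls)] -/
theorem wall_le_grid (r : ℕ) : wall r ≤ grid r r := by
  intro p q h
  rw [grid_adj]
  rcases h with h | ⟨h1, ⟨h2, -⟩ | ⟨h2, -⟩⟩
  · exact Or.inl h
  · exact Or.inr ⟨h1, Or.inl h2⟩
  · exact Or.inr ⟨h1, Or.inr h2⟩

/-! ### Topological minors -/

/-- `IsTopologicalMinor H G` (`H ≼ₜ G`): **`H` is a topological minor of `G`**, i.e. `G` contains a
subdivision of `H` as a subgraph: there are an injective map `f` on vertices (the branch vertices)
and, for every ordered pair of adjacent vertices `u, v` of `H`, a path `P u v` of `G` from `f u` to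
`f v` such that (i) the only branch vertices on `P u v` are its two ends and (ii) the paths of two
distinct edges have only branch vertices in common (hence, by (i), only common ends). The paths of
the two orientations `(u, v)`, `(v, u)` of one edge are deliberately unrelated: choosing one
orientation per edge yields a subdivision of `H` inside `G`, and conversely a subdivision yields
such a family (reverse the path for the opposite orientation), so this is the usual notion.
Equivalently (GIRS §2), `H` arises from `G` by edge removals, vertex removals and suppressions of
degree-`2` vertices. [cite: GalesiEtAl2023, §2 (topological minors)] -/
def IsTopologicalMinor {α β : Type*} (H : SimpleGraph α) (G : SimpleGraph β) : Prop :=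
  ∃ (f : α → β) (P : ∀ u v : α, H.Adj u v → G.Walk (f u) (f v)),
    Function.Injective f ∧
    (∀ (u v : α) (h : H.Adj u v), (P u v h).IsPath) ∧
    (∀ (u v : α) (h : H.Adj u v) (w : α), f w ∈ (P u v h).support → w = u ∨ w = v) ∧
    (∀ (u v u' v' : α) (h : H.Adj u v) (h' : H.Adj u' v'), s(u, v) ≠ s(u', v') →
      ∀ x, x ∈ (P u v h).support → x ∈ (P u' v' h').support → x ∈ Set.range f)

@[inherit_doc] scoped infixl:50 " ≼ₜ " => IsTopologicalMinor

/-- Every graph is a topological minor of itself (identity on vertices, one-edge paths).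
[folklore] -/
theorem IsTopologicalMinor.refl {α : Type*} (H : SimpleGraph α) : H ≼ₜ H := by
  refine ⟨id, fun u v h => h.toWalk, Function.injective_id, fun u v h => ?_, fun u v h w hw => ?_,
    fun u v u' v' h h' _ x hx _ => ⟨x, rfl⟩⟩
  · exact Walk.IsPath.cons Walk.IsPath.nil (by simp [h.ne])
  · simpa [Walk.support_cons, Walk.support_nil] using hw

/-- Topological minors persist in supergraphs on the same vertex set. [folklore] -/
theorem IsTopologicalMinor.mono_right {α β : Type*} {H : SimpleGraph α} {G G' : SimpleGraph β}
    (hG : G ≤ G') (h : H ≼ₜ G) : H ≼ₜ G' := by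
  obtain ⟨f, P, hf, hpath, hbranch, hdisj⟩ := h
  refine ⟨f, fun u v h => (P u v h).mapLe hG, hf, fun u v h => (hpath u v h).mapLe hG,
    fun u v h w hw => hbranch u v h w ?_, fun u v u' v' h h' hne x hx hx' => hdisj u v u' v' h h' hne x ?_ ?_⟩
  · simpa [Walk.support_mapLe_eq_support] using hw
  · simpa [Walk.support_mapLe_eq_support] using hx
  · simpa [Walk.support_mapLe_eq_support] using hx'

/-- Topological minors compose with subgraph embeddings on the left: if `H'` maps injectively and
edge-preservingly into `H` (e.g. `H'` is a subgraph of `H`) and `H ≼ₜ G`, then `H' ≼ₜ G` (restrict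
the branch vertices and the path family). [folklore] -/
theorem IsTopologicalMinor.of_hom {α α' β : Type*} {H : SimpleGraph α} {H' : SimpleGraph α'}
    {G : SimpleGraph β} (φ : H' →g H) (hφ : Function.Injective φ) (h : H ≼ₜ G) : H' ≼ₜ G := by
  obtain ⟨f, P, hf, hpath, hbranch, hdisj⟩ := h
  refine ⟨f ∘ φ, fun u v h => P (φ u) (φ v) (φ.map_adj h), hf.comp hφ,
    fun u v h => hpath _ _ _, fun u v h w hw => ?_, fun u v u' v' h h' hne x hx hx' => ?_⟩
  · rcases hbranch _ _ _ (φ w) hw with h1 | h1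
    · exact Or.inl (hφ h1)
    · exact Or.inr (hφ h1)
  · have hne' : s(φ u, φ v) ≠ s(φ u', φ v') := by
      intro heq
      apply hne
      rcases Sym2.eq_iff.1 heq with ⟨h1, h2⟩ | ⟨h1, h2⟩
      · rw [hφ h1, hφ h2]
      · rw [Sym2.eq_iff]; exact Or.inr ⟨hφ h1, hφ h2⟩
    obtain ⟨w, rfl⟩ := hdisj _ _ _ _ _ _ hne' x hx hx'
    rcases hbranch _ _ _ w hx with rfl | rfl
    · exact ⟨u, rfl⟩
    · exact ⟨v, rfl⟩

end Literature.Combinatorics.SimpleGraph
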